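import Summits.KontsevichZagierPeriods.KontsevichZagierPeriods.Theorems.LiftingCriteriaCubeNashNormalFormTame
import Literature.NumberTheory.Transcendental.SemialgebraicMaps
import Literature.NumberTheory.Transcendental.CubeChartBasics
import Literature.NumberTheory.Transcendental.CubeChartDyadic
import Literature.NumberTheory.Transcendental.CubeMonomialGerms
import Literature.NumberTheory.Transcendental.CubeChartMonomial
import Literature.NumberTheory.Transcendental.SlabCharts
import Literature.NumberTheory.Transcendental.CubeChartBinomialRepair
import Mathlib.RingTheory.Polynomial.Resultant.Basic
import Mathlib.Analysis.Analytic.Basic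
import Mathlib.Analysis.Calculus.FDeriv.Analytic
import Mathlib.MeasureTheory.Measure.Lebesgue.Basic

/-!
# Crux `CubeNashNormalForm` (stmt-KontsevichZagierPeriods-3574), line `Sketch` — stub `stub_jungFinish`

Worker start file generated by the line lead: the statement below is BYTE-IDENTICAL to the registered
stub signature (do not edit it; the gate matches name + signature). Replace `sorry` by a proof; add
helper lemmas ABOVE the theorem in this namespace (docstring on every declaration); keep ≤ 400 lines
(generic lemmas belong in a Literature/ file proposed separately and imported here).
-/

noncomputable section

open Set MeasureTheory
open Literature.ModelTheory.ExponentialFields (IsSemialgebraic)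
open Literature.NumberTheory.Transcendental
open Literature.NumberTheory.Transcendental.KZ

namespace Summit.KontsevichZagierPeriods.SymplecticScissors.CubeNashNormalFormJungFinish

/-- **Stub S4 `stub_jungFinish` (toric repair of the corner binomials, M–L).** From `TORIC(d+1)` and
the prepared slab atlas `PREP(d)`: `E(d+1)`. Dyadic localisation of the `(d+1)`-cube into `2ᵈ⁺¹`
half-cubes rescaled to the unit cube (so every cube-monomial becomes a pure monomial times a positive
unit), then the simplicial monomial charts of `TORIC(d+1)` for the finite set of all exponents occurring
(and their doubles): on each chart `M₁u₁ + M₂u₂ = M · (unit > 0)` and `(M u)² + M₅u₅ = M' · (unit > 0)`;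
compositions of FORMAT charts are FORMAT charts (chain rule, `ℚ`-semialgebraic composition), images stay
disjoint, and analytic images of null sets are null. [Fulton 1993, §2.6; Kontsevich–Zagier 2001, §1.2] -/
theorem stub_jungFinish : ∀ d : ℕ, (∀ (S : Finset (Fin (d + 1) → ℕ)), ∃ (M : ℕ) (A : Fin M → Matrix (Fin (d + 1)) (Fin (d + 1)) ℕ), (∀ c, ((A c).map (fun t : ℕ => (t : ℝ))).det ≠ 0) ∧ Pairwise (fun c c' => Disjoint ((fun v : Fin (d + 1) → ℝ => fun i => ∏ j, v j ^ A c i j) '' Set.pi Set.univ (fun _ : Fin (d + 1) => Set.Ioo (0:ℝ) 1)) ((fun v : Fin (d + 1) → ℝ => fun i => ∏ j, v j ^ A c' i j) '' Set.pi Set.univ (fun _ : Fin (d + 1) => Set.Ioo (0:ℝ) 1))) ∧ MeasureTheory.volume (Set.pi Set.univ (fun _ : Fin (d + 1) => Set.Ioo (0:ℝ) 1) \ ⋃ c, (fun v : Fin (d + 1) → ℝ => fun i => ∏ j, v j ^ A c i j) '' Set.pi Set.univ (fun _ : Fin (d + 1) => Set.Ioo (0:ℝ) 1)) = 0 ∧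 ∀ c, ∀ a ∈ S, ∀ b ∈ S, (∀ j, ∑ i, A c i j * a i ≤ ∑ i, A c i j * b i) ∨ (∀ j, ∑ i, A c i j * b i ≤ ∑ i, A c i j * a i)) → (∀ (B : Set (Fin (d + 1) → ℝ)), IsSemialgebraic ℚ B → Bornology.IsBounded B → ∀ (k : ℕ) (Q : Fin k → MvPolynomial (Fin (d + 1)) ℚ), (∀ j, Q j ≠ 0) → ∃ (N : ℕ) (Φ : Fin N → (Fin (d + 1) → ℝ) → (Fin (d + 1) → ℝ)), (∀ i, (AnalyticOnNhd ℝ (Φ i) (Set.pi Set.univ (fun _ : Fin (d + 1) => Set.Icc (0:ℝ) 1)) ∧ IsSemialgebraicMapOn ℚ (Set.pi Set.univ (fun _ : Fin (d + 1) => Set.Ioo (0:ℝ) 1)) (Φ i) ∧ Set.InjOn (Φ i) (Set.pi Set.univ (fun _ : Fin (d + 1) => Set.Ioo (0:ℝ) 1)) ∧ ∀ x ∈ Set.pi Set.univ (fun _ : Fin (d + 1) => Set.Ioo (0:ℝ) 1), (fderiv ℝ (Φ i) x).det ≠ 0)) ∧ (∀ i, Φ i '' Set.pi Set.univ (fun _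 : Fin (d + 1) => Set.Ioo (0:ℝ) 1) ⊆ B) ∧ Pairwise (fun i i' => Disjoint (Φ i '' Set.pi Set.univ (fun _ : Fin (d + 1) => Set.Ioo (0:ℝ) 1)) (Φ i' '' Set.pi Set.univ (fun _ : Fin (d + 1) => Set.Ioo (0:ℝ) 1))) ∧ MeasureTheory.volume (B \ ⋃ i, Φ i '' Set.pi Set.univ (fun _ : Fin (d + 1) => Set.Ioo (0:ℝ) 1)) = 0 ∧ ∀ i j, (∃ U : Set (Fin (d + 1) → ℝ), IsOpen U ∧ Set.pi Set.univ (fun _ : Fin (d + 1) => Set.Icc (0:ℝ) 1) ⊆ U ∧ ∃ (a₀ b₀ : Fin (d + 1) → ℕ) (e₀ : (Fin (d + 1) → ℝ) → ℝ) (L₁ L₂ : ℕ) (m₁ : Fin L₁ → ℕ) (a₁ b₁ a₂ b₂ : Fin L₁ → Fin (d + 1) → ℕ) (e₁ e₂ : Fin L₁ → (Fin (d + 1) → ℝ) → ℝ) (m₂ : Fin L₂ → ℕ) (a₃ b₃ a₄ b₄ a₅ b₅ : Fin L₂ → Fin (d + 1) → ℕ) (e₃ e₄ e₅ : Fin L₂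 → (Fin (d + 1) → ℝ) → ℝ), AnalyticOnNhd ℝ e₀ U ∧ (∀ x ∈ U, e₀ x ≠ 0) ∧ (∀ l, AnalyticOnNhd ℝ (e₁ l) U ∧ AnalyticOnNhd ℝ (e₂ l) U ∧ ∀ x ∈ U, 0 < e₁ l x ∧ 0 < e₂ l x) ∧ (∀ l, AnalyticOnNhd ℝ (e₃ l) U ∧ AnalyticOnNhd ℝ (e₄ l) U ∧ AnalyticOnNhd ℝ (e₅ l) U ∧ ∀ x ∈ U, 0 < e₃ l x ∧ 0 < e₄ l x ∧ 0 < e₅ l x) ∧ ∀ x ∈ U, (fun x => MvPolynomial.aeval (Φ i x) (Q j)) x = (∏ i, x i ^ a₀ i * (1 - x i) ^ b₀ i) * e₀ x * (∏ l, ((∏ i, x i ^ a₁ l i * (1 - x i) ^ b₁ l i) * e₁ l x + (∏ i, x i ^ a₂ l i * (1 - x i) ^ b₂ l i) * e₂ l x) ^ m₁ l) * ∏ l, (((∏ i, x i ^ a₃ l i * (1 - x i) ^ b₃ l i) * e₃ l x + (∏ i, x i ^ a₄ l i * (1 - x i) ^ b₄ l i) * e₄ l x) ^ 2 + (∏ i,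 x i ^ a₅ l i * (1 - x i) ^ b₅ l i) * e₅ l x) ^ m₂ l)) → (∀ (B : Set (Fin (d + 1) → ℝ)), IsSemialgebraic ℚ B → Bornology.IsBounded B → ∀ (k : ℕ) (Q : Fin k → MvPolynomial (Fin (d + 1)) ℚ), (∀ j, Q j ≠ 0) → ∃ (N : ℕ) (Φ : Fin N → (Fin (d + 1) → ℝ) → (Fin (d + 1) → ℝ)), (∀ i, (AnalyticOnNhd ℝ (Φ i) (Set.pi Set.univ (fun _ : Fin (d + 1) => Set.Icc (0:ℝ) 1)) ∧ IsSemialgebraicMapOn ℚ (Set.pi Set.univ (fun _ : Fin (d + 1) => Set.Ioo (0:ℝ) 1)) (Φ i) ∧ Set.InjOn (Φ i) (Set.pi Set.univ (fun _ : Fin (d + 1) => Set.Ioo (0:ℝ) 1)) ∧ ∀ x ∈ Set.pi Set.univ (fun _ : Fin (d + 1) => Set.Ioo (0:ℝ) 1), (fderiv ℝ (Φ i) x).det ≠ 0)) ∧ (∀ i, Φ i '' Set.pi Set.univ (fun _ : Fin (d + 1) => Set.Ioo (0:ℝ) 1) ⊆ B) ∧ Pairwise (fun i i' => Disjoint (Φ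 i '' Set.pi Set.univ (fun _ : Fin (d + 1) => Set.Ioo (0:ℝ) 1)) (Φ i' '' Set.pi Set.univ (fun _ : Fin (d + 1) => Set.Ioo (0:ℝ) 1))) ∧ MeasureTheory.volume (B \ ⋃ i, Φ i '' Set.pi Set.univ (fun _ : Fin (d + 1) => Set.Ioo (0:ℝ) 1)) = 0 ∧ ∀ i j, (∃ U : Set (Fin (d + 1) → ℝ), IsOpen U ∧ Set.pi Set.univ (fun _ : Fin (d + 1) => Set.Icc (0:ℝ) 1) ⊆ U ∧ ∃ (a b : Fin (d + 1) → ℕ) (e : (Fin (d + 1) → ℝ) → ℝ), AnalyticOnNhd ℝ e U ∧ (∀ x ∈ U, e x ≠ 0) ∧ ∀ x ∈ U, (fun x => MvPolynomial.aeval (Φ i x) (Q j)) x = (∏ i, x i ^ a i * (1 - x i) ^ b i) * e x)) := by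
  intro d hT hP B hB hBb k Q hQ
  obtain ⟨N, Φ, hfmt, hΦB, hdisj, hnull, hprep⟩ := hP B hB hBb k Q hQ
  exact exists_fin_atlas_cubeMonomial_of_binomialForm hT
    (G := fun j y => MvPolynomial.aeval y (Q j)) hfmt hΦB hdisj hnull hprep

end Summit.KontsevichZagierPeriods.SymplecticScissors.CubeNashNormalFormJungFinish

end
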